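import Summits.BirchSwinnertonDyer.BirchSwinnertonDyer.Theorems.PrintCFramJZeroThreeUnitRegimeValuePsi
import Summits.BirchSwinnertonDyer.BirchSwinnertonDyer.Theorems.PrintCFramJZeroThreeUnitRegimeValuePsiBernoulliOdd
import Summits.BirchSwinnertonDyer.BirchSwinnertonDyer.Theorems.PrintCFramJZeroThreeUnitRegimeKroneckerCharacters
import Summits.BirchSwinnertonDyer.Rank1Residual.X12.O11.RouteUEulerCriterionNat
import HarnessLib


/-! # K12r@3 — the «3-unit regime» CLASS THEOREMS for `ψ = χ₋₄` (`d* = −1`; classes `432b`, `3888p`,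
# `3888s`, `3888t`) and `ψ = χ₈` (`d* = 2`; classes `576a`, `1728a`, `15552a`, `15552b`, `15552c`) with
# the Heegner field `ℚ(√−23)`: instances of `bsdp_three_of_unitRegime_valuePsi` with the Bernoulli
# certificates DECIDED (cell `bsd-print-cfram`, seat p3 g2; regime N = `TorsionFreeFrameBSDThree`,
# stmt-BirchSwinnertonDyer-20698; P3-UNIT-REGIME-CENSUS §3 «χ₄/χ₈-type ψ»)

HONEST FRAMING (cell `bsd-print-cfram`, run/shared/lean/pub/bsd-print-cfram/, D-0131 (2) print
tier; verbatim in every file of the cell): the cell works the partition leaf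
`CornerF ∧ p ramified in the CM field K` (LADDER-BSD row K7r = B13; W-ALL row 12r) in PARTITION
currency — a leaf or a cell counts only when its theorem is in the kernel BY NAME. Nothing here is a
Literature statement, no named fact is introduced, nothing is asserted about BSD; beyond-print: NO
(Kriz–Li 2019 Thm. 1.20 + Rem. 3.10 at `p = 3`, §10.3's mechanism; finite certificates by `decide`;
THEOREMS ONLY).

* §1 `ψ = χ₋₄` (ODD, conductor `4`), `K = ℚ(√−23)` (`2`, `3` split): certificates `3 ∤ Σ_{j<4} χ₄(j)j = −2`
  and `3 ∥ Σ_{j<276} χ₄(j)(j/23)(j/3)j = −2208`; class theorem `bsdp_three_of_unitRegime_chiFour_23` for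
  `W ≅ y² = x³ + d·m²`, `d ∈ {−1, 3}` (`432b`: `k = −4`; `3888p/s/t`: `k = 12, 48, 3`), bad primes `⊂ {2, 3}`.
* §2 `ψ = χ₈` (EVEN, conductor `8`), `K = ℚ(√−23)`: certificates `3 ∤ Σ_{j<184} χ₈(j)(j/23)j = −736` and
  `3 ∥ Σ_{j<24} χ₈(j)(j/3)j = −48`; class theorem `bsdp_three_of_unitRegime_chiEight_23` for `d = 2`
  (`576a`: `k = 8`; `1728a`: `k = 2`; `15552a/b/c`: `k = 72, 288, 18`), bad primes `⊂ {2, 3}`.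
Displayed binders = those of `bsdp_three_of_unitRegime_five_eleven` (p546876): Route U's data, PUB facts,
twin, `htamW`/`hSW`/`hSd`, level-`0` generator, `hW`/`h6`/`h2`/`hS`. Reach: 9 classes, all regime N
(p546152's criterion; P3-UNIT-REGIME-CENSUS §2: `1728a`, `3888t` booked by Kriz–Li Thm. 1.23, the other
7 UNBOOKED before).
References: [KrizLi2019] Thm. 1.20 (pp. 7–8), Rem. 3.10 (p. 26), Thm. 1.23, §1.5 (1), §10.3;
[Washington1997] Thm. 4.2; [Cox2013] §1.C; [GrossZagier1986] V.§2; [Miller2011LMS] Def. 1.1.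
-/

set_option linter.dupNamespace false
set_option autoImplicit false

noncomputable section

open scoped Classical NumberTheorySymbols
open NumberField Field WeierstrassCurve DirichletCharacter
open Literature.NumberTheory.EllipticCurves Literature.NumberTheory.EllipticCurves.KrizLi2019
  Literature.NumberTheory.EllipticCurves.ModularForms Literature.NumberTheory.QuadraticFields
  Summit.BirchSwinnertonDyer.Rank1Residual.X12.O11.RouteU

namespace Summit.BirchSwinnertonDyer.BirchSwinnertonDyer.Theorems.PrintCFram

/-! ## §1 `ψ = χ₋₄`, `K = ℚ(√−23)` -/

set_option maxRecDepth 20000 in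
/-- **CERTIFICATE `3 ∤ Σ_{j<4} χ₄(j)·j = −2`** (`‖B_{1,χ₋₄}‖₃ = 1`: `B_{1,χ₋₄} = −1/2`). [cite: KrizLi2019, Thm. 1.20 (p. 8) and §1.5 (1)]
[cite: Washington1997, Thm. 4.2] -/
theorem certOne_chiFour :
    ¬ ((3 : ℤ) ∣ ∑ j ∈ Finset.range 4, (ZMod.χ₄ (j : ZMod 4) : ℤ) * (j : ℤ)) := by
  simp_rw [ZMod.χ₄_nat_eq_if_mod_four]
  decide

set_option maxRecDepth 200000 in
/-- **CERTIFICATE `3 ∥ Σ_{j<276} χ₄(j)(j/23)(j/3)·j = −2208`** (`θ₂' = χ₋₄χ₂₃ω`, level `276`).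
[cite: KrizLi2019, Thm. 1.20 (p. 8) and §1.5 (1)] [cite: Washington1997, Thm. 4.2] -/
theorem certTwo_chiFour_23 :
    ((3 : ℤ) ∣ ∑ j ∈ Finset.range (4 * 23 * 3),
      (ZMod.χ₄ (j : ZMod 4) : ℤ) * J((j : ℤ) | 23) * J((j : ℤ) | 3) * (j : ℤ) ^ (0 + 1)) ∧
    ¬ ((3 : ℤ) ^ 2 ∣ ∑ j ∈ Finset.range (4 * 23 * 3),
      (ZMod.χ₄ (j : ZMod 4) : ℤ) * J((j : ℤ) | 23) * J((j : ℤ) | 3) * (j : ℤ) ^ (0 + 1)) := by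
  simp_rw [ZMod.χ₄_nat_eq_if_mod_four, jacobiSym_prime_eq_ite_nat 23 (by norm_num) (by norm_num),
    jacobiSym_prime_eq_ite_nat 3 (by norm_num) (by norm_num)]
  constructor
  · decide +kernel
  · decide +kernel

/-- A prime dividing `4` or `8` is `2`. [folklore] -/
theorem eq_two_of_prime_dvd_two_pow {ℓ k : ℕ} (hℓ : ℓ.Prime) (h : ℓ ∣ 2 ^ k) : ℓ = 2 :=
  (Nat.prime_dvd_prime_iff_eq hℓ Nat.prime_two).mp (hℓ.dvd_of_dvd_pow h)

/-- **BSD(W, 3) in the 3-UNIT REGIME for `ψ = χ₋₄`, `K = ℚ(√−23)`** [`432b` (`d = −1`), `3888p/s/t`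
(`d = 3`)] — for every globally minimal `W/ℚ` of analytic rank one with `C • W = y² = x³ + d·m²`,
`d ∈ {−1, 3}`, `dm²` sixth-power-free, bad primes `⊂ {2, 3}`, and `K` of discriminant `−23`:
`bsdp_three_of_unitRegime_valuePsi` with `ψ = χ₋₄` (`PrintCFram.exists_chiFour_three`: primitive, odd,
`χ₄(3) = −1`, `χ₄(ℓ) = J(d | ℓ)` at `ℓ ≡ 1 (3)`), `ε_K = (·/23)↑`, and `hB` by
`bernoulli_hypothesis_three_of_odd_values` + the two certificates above. Displayed: Route U's data, PUB
facts, twin, certificates, generator, `hW`/`h6`/`h2`/`hS` (`h2` vacuous: `2` is bad).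
[cite: KrizLi2019, Thm. 1.20 (pp. 7–8), Rem. 3.10 (p. 26), §10.3]
[cite: GrossZagier1986, V.§2 (pp. 310–312)] [cite: Miller2011LMS, Def. 1.1] -/
theorem bsdp_three_of_unitRegime_chiFour_23
    (hKL : KrizLi2019.thm120_padicLogHeegner_unit_of_bernoulli)
    (hRem : KrizLi2019.rem310_padicLogHeegner_integral)
    (W : WeierstrassCurve ℚ) [W.IsElliptic] [W.IsGloballyMinimal] [NeZero (W.conductorNorm ℤ)]
    {d m : ℤ} (hdset : d = -1 ∨ d = 3) (hm : m ≠ 0)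
    (hW : ∃ C : VariableChange ℚ, C • W = mordellCurve ((d : ℚ) * (m : ℚ) ^ 2))
    (h6 : ∀ ℓ : ℕ, ℓ.Prime → ¬ ((ℓ : ℤ) ^ 6 ∣ d * m ^ 2))
    (h2 : (haveI : Fact (Nat.Prime 2) := ⟨Nat.prime_two⟩; W.HasGoodReductionAtPrime 2) →
      W.LFunction 2 = 0)
    (hS : ∀ ℓ : ℕ, (hℓ : ℓ.Prime) → ¬ (haveI := Fact.mk hℓ; W.HasGoodReductionAtPrime ℓ) →
      ℓ = 2 ∨ ℓ = 3)
    (K : Type) [Field K] [NumberField K] [NeZero (NumberField.discr K).natAbs]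
    (hK : IsImaginaryQuadratic K) (hdK : NumberField.discr K = -23)
    (D : ModularParametrizationData W (W.conductorNorm ℤ))
    (H : HeegnerDatum (W.conductorNorm ℤ) (NumberField.discr K)) (ι : K →+* ℂ)
    (ιp : K →+* ℚ_[3]) (P : (W.baseChange K).toAffine.Point)
    (hGZ : gross_zagier (W.conductorNorm ℤ) W K) (hKo : kolyvagin (W.conductorNorm ℤ) W K)
    (hGZK : rank_eq_analyticRank_of_analyticRank_le_one) (hmod : hasEntireLFunction_rat)
    (hP : WeierstrassCurve.Affine.Point.map ι.toRatAlgHom P = heegnerPointComplex D H)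
    (hr : W.analyticRank = 1)
    (hLt : (W.quadraticTwist (NumberField.discr K : ℚ)).entireLFunction 1 ≠ 0)
    (Wd : WeierstrassCurve ℚ) [Wd.IsElliptic] [Wd.IsGloballyMinimal] (Cd : VariableChange ℚ)
    (hWd : Cd • W.quadraticTwist (NumberField.discr K : ℚ) = Wd)
    (htw : ∃ q : ℚ, Wd.entireLFunction 1 / (Wd.realPeriodRat : ℂ) = (q : ℂ) ∧
      padicValRat 3 q = (padicValNat 3 Wd.shaOrder : ℤ) + padicValNat 3 Wd.tamagawaProduct -
        2 * padicValNat 3 Wd.torsionOrder)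
    (htam : padicValNat 3 Wd.tamagawaProduct = padicValNat 3 W.tamagawaProduct)
    (hu : padicValRat 3 (Cd.u : ℚ) = 0)
    (htamW : ¬ 3 ∣ W.tamagawaProduct)
    (hSW : ∀ [Finite W.sha], ¬ 3 ∣ W.shaOrder) (hSd : ∀ [Finite Wd.sha], ¬ 3 ∣ Wd.shaOrder)
    (ω : DirichletCharacter ℚ_[3] 3) (hω : KrizLi2019.IsTeichmullerCharacter ω)
    [Finite (AddCommGroup.torsion (W.baseChange K).toAffine.Point)]
    (crd : (W.baseChange K).toAffine.Point →+ ℤ) (g : (W.baseChange K).toAffine.Point)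
    (hg : crd g = 1) (hker : ∀ x, crd x = 0 → IsOfFinAddOrder x)
    (hiv : ∀ x : (W.baseChange K).toAffine.Point, 3 • x = 0 → x = 0)
    (hg0 : ‖Castella2018.padicLogOmega W 3 ιp g‖ = 1) :
    BSDp W 3 := by
  haveI : Fact (Nat.Prime 23) := ⟨by norm_num⟩
  obtain ⟨χ, hχ2, hχ⟩ := exists_chiFour_three
  obtain ⟨χr, hχr⟩ := exists_legendreCharacter_three 23
  have hrd : 23 ∣ (NumberField.discr K).natAbs := by rw [hdK]; decide
  have hsq : Squarefree d := by
    rcases hdset with rfl | rfl <;> rw [← Int.squarefree_natAbs]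
    · show Squarefree (1 : ℕ); exact squarefree_one
    · show Squarefree (3 : ℕ); exact Nat.prime_three.squarefree
  refine bsdp_three_of_unitRegime_valuePsi hKL hRem χ (fun a => (ZMod.χ₄ (a : ZMod 4) : ℤ)) hχ
    (chiFour_isPrimitive χ hχ) hχ2 (by norm_num) (by decide) (r := 23) (by norm_num)
    (by norm_num) (by norm_num) (fun ℓ hℓ hℓf => ?_) χr hχr W hsq hm hW h6 (fun ℓ hℓ hℓ1 => ?_) h2
    (fun ℓ hℓ hbad => ?_) K hK (by rw [hdK]; norm_num) hrd D H ι ιp P hGZ hKo hGZK hmod hP hr hLt Wd Cd hWd htw htam hu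
      htamW hSW hSd ω hω ?_ crd g hg hker hiv hg0
  · -- the conductor prime `2` splits (`−23 ≡ 1 (mod 8)`)
    have h2' : ℓ = 2 := eq_two_of_prime_dvd_two_pow (k := 2) hℓ (by simpa using hℓf)
    exact ⟨fun _ => by norm_num, fun h => absurd h2' h⟩
  · -- trace-form compatibility `χ₄(ℓ) = J(d | ℓ)` at `ℓ ≡ 1 (mod 3)`
    have hodd : Odd ℓ := hℓ.odd_of_ne_two (by omega)
    rcases hdset with rfl | rfl
    · exact chiFour_eq_jacobiSym_neg_one hodd
    · exact chiFour_eq_jacobiSym_three hodd hℓ1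
  · rcases hS ℓ hℓ hbad with h | h
    · exact Or.inr (Or.inl (by rw [h]; norm_num))
    · exact Or.inl h
  · exact bernoulli_hypothesis_three_of_odd_values χ (fun a => (ZMod.χ₄ (a : ZMod 4) : ℤ)) χr ω hχ
      hχ2 (chiFour_isPrimitive χ hχ) hχr hω (by norm_num) (by norm_num) (by norm_num)
      (by norm_num) hrd (chiFour_odd χ hχ) certOne_chiFour certTwo_chiFour_23.1 certTwo_chiFour_23.2

/-! ## §2 `ψ = χ₈`, `K = ℚ(√−23)` -/

set_option maxRecDepth 200000 in
/-- **CERTIFICATE `3 ∤ Σ_{j<184} χ₈(j)(j/23)·j = −736`** (`θ₁ = χ₈χ₂₃`, level `184`; `h(−184) = 4`).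
[cite: KrizLi2019, Thm. 1.20 (p. 8) and §1.5 (1)] [cite: Washington1997, Thm. 4.2] -/
theorem certOne_chiEight_23 :
    ¬ ((3 : ℤ) ∣ ∑ j ∈ Finset.range (8 * 23),
      (ZMod.χ₈ (j : ZMod 8) : ℤ) * J((j : ℤ) | 23) * (j : ℤ)) := by
  simp_rw [ZMod.χ₈_nat_eq_if_mod_eight, jacobiSym_prime_eq_ite_nat 23 (by norm_num) (by norm_num)]
  decide +kernel

set_option maxRecDepth 20000 in
/-- **CERTIFICATE `3 ∥ Σ_{j<24} χ₈(j)(j/3)·j = −48`** (`θ₂ = χ₈ω`, level `24`).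
[cite: KrizLi2019, Thm. 1.20 (p. 8) and §1.5 (1)] [cite: Washington1997, Thm. 4.2] -/
theorem certTwo_chiEight :
    ((3 : ℤ) ∣ ∑ j ∈ Finset.range (8 * 3),
      (ZMod.χ₈ (j : ZMod 8) : ℤ) * J((j : ℤ) | 3) * (j : ℤ) ^ (0 + 1)) ∧
    ¬ ((3 : ℤ) ^ 2 ∣ ∑ j ∈ Finset.range (8 * 3),
      (ZMod.χ₈ (j : ZMod 8) : ℤ) * J((j : ℤ) | 3) * (j : ℤ) ^ (0 + 1)) := by
  simp_rw [ZMod.χ₈_nat_eq_if_mod_eight, jacobiSym_prime_eq_ite_nat 3 (by norm_num) (by norm_num)]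
  constructor
  · decide +kernel
  · decide +kernel

/-- **BSD(W, 3) in the 3-UNIT REGIME for `ψ = χ₈`, `K = ℚ(√−23)`** [`576a`, `1728a`, `15552a/b/c`
(`d = 2`)] — for every globally minimal `W/ℚ` of analytic rank one with `C • W = y² = x³ + 2·m²`,
`2m²` sixth-power-free, bad primes `⊂ {2, 3}`, and `K` of discriminant `−23`:
`bsdp_three_of_unitRegime_valuePsi` with `ψ = χ₈` (`PrintCFram.exists_chiEight_three`: primitive, even,
`χ₈(3) = −1`, `χ₈(ℓ) = J(2 | ℓ)`), `ε_K = (·/23)↑`, and `hB` by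
`bernoulli_hypothesis_three_of_even_values` + the two certificates above.
[cite: KrizLi2019, Thm. 1.20 (pp. 7–8), Rem. 3.10 (p. 26), §10.3]
[cite: GrossZagier1986, V.§2 (pp. 310–312)] [cite: Miller2011LMS, Def. 1.1] -/
theorem bsdp_three_of_unitRegime_chiEight_23
    (hKL : KrizLi2019.thm120_padicLogHeegner_unit_of_bernoulli)
    (hRem : KrizLi2019.rem310_padicLogHeegner_integral)
    (W : WeierstrassCurve ℚ) [W.IsElliptic] [W.IsGloballyMinimal] [NeZero (W.conductorNorm ℤ)]
    {d m : ℤ} (hdset : d = 2) (hm : m ≠ 0)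
    (hW : ∃ C : VariableChange ℚ, C • W = mordellCurve ((d : ℚ) * (m : ℚ) ^ 2))
    (h6 : ∀ ℓ : ℕ, ℓ.Prime → ¬ ((ℓ : ℤ) ^ 6 ∣ d * m ^ 2))
    (h2 : (haveI : Fact (Nat.Prime 2) := ⟨Nat.prime_two⟩; W.HasGoodReductionAtPrime 2) →
      W.LFunction 2 = 0)
    (hS : ∀ ℓ : ℕ, (hℓ : ℓ.Prime) → ¬ (haveI := Fact.mk hℓ; W.HasGoodReductionAtPrime ℓ) →
      ℓ = 2 ∨ ℓ = 3)
    (K : Type) [Field K] [NumberField K] [NeZero (NumberField.discr K).natAbs]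
    (hK : IsImaginaryQuadratic K) (hdK : NumberField.discr K = -23)
    (D : ModularParametrizationData W (W.conductorNorm ℤ))
    (H : HeegnerDatum (W.conductorNorm ℤ) (NumberField.discr K)) (ι : K →+* ℂ)
    (ιp : K →+* ℚ_[3]) (P : (W.baseChange K).toAffine.Point)
    (hGZ : gross_zagier (W.conductorNorm ℤ) W K) (hKo : kolyvagin (W.conductorNorm ℤ) W K)
    (hGZK : rank_eq_analyticRank_of_analyticRank_le_one) (hmod : hasEntireLFunction_rat)
    (hP : WeierstrassCurve.Affine.Point.map ι.toRatAlgHom P = heegnerPointComplex D H)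
    (hr : W.analyticRank = 1)
    (hLt : (W.quadraticTwist (NumberField.discr K : ℚ)).entireLFunction 1 ≠ 0)
    (Wd : WeierstrassCurve ℚ) [Wd.IsElliptic] [Wd.IsGloballyMinimal] (Cd : VariableChange ℚ)
    (hWd : Cd • W.quadraticTwist (NumberField.discr K : ℚ) = Wd)
    (htw : ∃ q : ℚ, Wd.entireLFunction 1 / (Wd.realPeriodRat : ℂ) = (q : ℂ) ∧
      padicValRat 3 q = (padicValNat 3 Wd.shaOrder : ℤ) + padicValNat 3 Wd.tamagawaProduct -
        2 * padicValNat 3 Wd.torsionOrder)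
    (htam : padicValNat 3 Wd.tamagawaProduct = padicValNat 3 W.tamagawaProduct)
    (hu : padicValRat 3 (Cd.u : ℚ) = 0)
    (htamW : ¬ 3 ∣ W.tamagawaProduct)
    (hSW : ∀ [Finite W.sha], ¬ 3 ∣ W.shaOrder) (hSd : ∀ [Finite Wd.sha], ¬ 3 ∣ Wd.shaOrder)
    (ω : DirichletCharacter ℚ_[3] 3) (hω : KrizLi2019.IsTeichmullerCharacter ω)
    [Finite (AddCommGroup.torsion (W.baseChange K).toAffine.Point)]
    (crd : (W.baseChange K).toAffine.Point →+ ℤ) (g : (W.baseChange K).toAffine.Point)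
    (hg : crd g = 1) (hker : ∀ x, crd x = 0 → IsOfFinAddOrder x)
    (hiv : ∀ x : (W.baseChange K).toAffine.Point, 3 • x = 0 → x = 0)
    (hg0 : ‖Castella2018.padicLogOmega W 3 ιp g‖ = 1) :
    BSDp W 3 := by
  haveI : Fact (Nat.Prime 23) := ⟨by norm_num⟩
  obtain ⟨χ, hχ2, hχ⟩ := exists_chiEight_three
  obtain ⟨χr, hχr⟩ := exists_legendreCharacter_three 23
  have hrd : 23 ∣ (NumberField.discr K).natAbs := by rw [hdK]; decide
  subst hdset
  have hsq : Squarefree (2 : ℤ) := by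
    rw [← Int.squarefree_natAbs]; show Squarefree (2 : ℕ); exact Nat.prime_two.squarefree
  refine bsdp_three_of_unitRegime_valuePsi hKL hRem χ (fun a => (ZMod.χ₈ (a : ZMod 8) : ℤ)) hχ
    (chiEight_isPrimitive χ hχ) hχ2 (by norm_num) (by decide) (r := 23) (by norm_num)
    (by norm_num) (by norm_num) (fun ℓ hℓ hℓf => ?_) χr hχr W hsq hm hW h6 (fun ℓ hℓ hℓ1 => ?_) h2
    (fun ℓ hℓ hbad => ?_) K hK (by rw [hdK]; norm_num) hrd D H ι ιp P hGZ hKo hGZK hmod hP hr hLt Wd Cd hWd htw htam hu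
      htamW hSW hSd ω hω ?_ crd g hg hker hiv hg0
  · have h2' : ℓ = 2 := eq_two_of_prime_dvd_two_pow (k := 3) hℓ (by simpa using hℓf)
    exact ⟨fun _ => by norm_num, fun h => absurd h2' h⟩
  · exact chiEight_eq_jacobiSym_two (hℓ.odd_of_ne_two (by omega))
  · rcases hS ℓ hℓ hbad with h | h
    · exact Or.inr (Or.inl (by rw [h]; norm_num))
    · exact Or.inl h
  · exact bernoulli_hypothesis_three_of_even_values χ (fun a => (ZMod.χ₈ (a : ZMod 8) : ℤ)) χr ω hχ
      hχ2 (chiEight_isPrimitive χ hχ) hχr hω (by norm_num) (by norm_num) (by norm_num)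
      (by norm_num) hrd (chiEight_even χ hχ) certOne_chiEight_23 certTwo_chiEight.1 certTwo_chiEight.2

end Summit.BirchSwinnertonDyer.BirchSwinnertonDyer.Theorems.PrintCFram

end
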